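import Summits.CriticalPhenomena.CardyFormulaZ2.Theses.CardySelfRefinement
import Literature.Probability.LatticeModels.DobrushinDiscretisation
import Mathlib.Analysis.Normed.Affine.Convex
import HarnessLib

/-!
# Forcing between discrete arc labels, and marker realizability: partial helper for stub `stub_discretisable` of line `crosscut-dictionary` for crux `LagHandOff` (stmt-CriticalPhenomena-10268)

`stub_discretisable` asks, for every Dobrushin domain `D`, for marker sets `A_δ, B_δ ⊆ ℂ` making
the G02 data `⟨D.carrier, δ, A_δ, B_δ⟩` admissible (`DiscreteDobrushin.IsZdAdmissible`) at all
small meshes.  The discrete arcs are cut out of `zdBoundary` by the distance comparison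
`infDist (δx) A' ≤ infDist (δx) (∂Ω ∖ A')` (`DiscreteDobrushin.zdDiscreteArc`), so the only
freedom is which boundary sites a marker set can *select*.  Writing `r x = infDist (δx) ∂Ω` and
`B x = closedBall (δx) (r x)` (the maximal closed disc about the site inside `Ω̄`), this file
proves the two halves of the exact answer:

* **forcing** (`exists_mem_zdDiscreteArc_of_closedBall_subset`): if `B y ⊆ ⋃ x ∈ X, B x` for
  boundary sites `X` and `y` lies on the discrete arc of `A'` (with `∂Ω ⊄ A'`), then some `x ∈ X`
  lies on that arc too — for EVERY marker set `A'`; hence (`not_isZdAdmissible_of_closedBall_subset`)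
  no marker choice separates `y ∈ zdArcA` from a covering family `X ⊆ zdArcB`: such data are never
  admissible.  This is the precise obstruction ("tie") generalising the unit-disc tie site of
  `Percolation/CanonicalDiscretisationTies.lean`;
* **realizability** (`mem_zdDiscreteArc_iff_of_disjoint`, `zdDiscreteArc_eq_of_markers`): for a
  marker set off `∂Ω`, a boundary site is selected iff the closure of the marker set meets its
  disc `B x`; so a finite set of witness points `p s ∈ B s` (one per intended site `s`, chosen
  outside the discs of the other boundary sites), padded by any compact set outside `Ω̄`
  (exterior padding never selects anything: `infDist_frontier_lt_dist_of_not_mem_closure`),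
  selects EXACTLY the intended sites.  Together: a labelling `zdBoundary = S_A ⊔ S_B` is realised
  by some markers iff no disc `B y`, `y ∈ S_A`, is covered by the discs of `S_B` and vice versa.

No lattice combinatorics is used; everything is metric (Mathlib `Metric.infDist`,
`IsClosed.exists_infDist_eq_dist`, `dist_add_dist_of_mem_segment`).
-/

noncomputable section

open MeasureTheory Filter Set Topology
open scoped BoundedContinuousFunction
open Literature.Probability.Percolation Literature.Probability.LatticeModels
open Literature.Probability.RandomPlanarGeometry Literature.Probability.Percolation.QuadCrossing
open Summit.CriticalPhenomena.CardyFormulaZ2.Theses.CardySelfRefinement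

namespace Summit.CriticalPhenomena.CardyFormulaZ2.Cruxes.LagHandOff.CrosscutDictionary

/-! ### Forcing: covered discs inherit the arc label -/

/-- **Forcing lemma.** Let `y` lie on the discrete arc of the marker set `A'` and suppose the
closed disc about `δy` of radius `infDist (δy) ∂Ω` is covered by the corresponding discs of the
boundary sites `X`.  If `∂Ω ⊄ A'`, some site of `X` lies on the discrete arc of `A'` as well —
whatever `A'` is.  (If every `x ∈ X` were off the arc, `closure A'` would miss every disc of `X`,
hence the disc of `y`, hence a nearest boundary point of `δy` lies in `∂Ω ∖ A'`, and `y` on the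
arc would put a point of `closure A'` in its disc.) [folklore] -/
theorem exists_mem_zdDiscreteArc_of_closedBall_subset {E : DiscreteDobrushin} {A' : Set ℂ}
    {y : Site 2} {X : Set (Site 2)} (hX : X ⊆ E.zdBoundary) (hy : y ∈ E.zdDiscreteArc A')
    (hne : (frontier E.Ω \ A').Nonempty)
    (hcover : Metric.closedBall (meshPoint E.δ y) (Metric.infDist (meshPoint E.δ y) (frontier E.Ω)) ⊆
      ⋃ x ∈ X, Metric.closedBall (meshPoint E.δ x) (Metric.infDist (meshPoint E.δ x) (frontier E.Ω))) :
    ∃ x ∈ X, x ∈ E.zdDiscreteArc A' := by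
  have hyB : meshPoint E.δ y ∈ Metric.closedBall (meshPoint E.δ y)
      (Metric.infDist (meshPoint E.δ y) (frontier E.Ω)) :=
    Metric.mem_closedBall_self Metric.infDist_nonneg
  obtain ⟨x₀, hx₀X, -⟩ : ∃ x ∈ X, meshPoint E.δ y ∈ Metric.closedBall (meshPoint E.δ x)
      (Metric.infDist (meshPoint E.δ x) (frontier E.Ω)) := by
    simpa only [mem_iUnion, exists_prop] using hcover hyB
  by_cases hA : A' = ∅
  · subst hA
    refine ⟨x₀, hx₀X, hX hx₀X, ?_⟩
    rw [Metric.infDist_empty]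
    exact Metric.infDist_nonneg
  by_contra hcon
  push Not at hcon
  -- every `x ∈ X` is off the arc, so `closure A'` misses its disc
  have hfar : ∀ x ∈ X, ∀ p ∈ closure A',
      Metric.infDist (meshPoint E.δ x) (frontier E.Ω) < dist (meshPoint E.δ x) p := by
    intro x hx p hp
    have h1 : ¬ (Metric.infDist (meshPoint E.δ x) A' ≤
        Metric.infDist (meshPoint E.δ x) (frontier E.Ω \ A')) := fun h => hcon x hx ⟨hX hx, h⟩
    push Not at h1
    calc Metric.infDist (meshPoint E.δ x) (frontier E.Ω)
        ≤ Metric.infDist (meshPoint E.δ x) (frontier E.Ω \ A') :=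
          Metric.infDist_le_infDist_of_subset sdiff_subset hne
      _ < Metric.infDist (meshPoint E.δ x) A' := h1
      _ = Metric.infDist (meshPoint E.δ x) (closure A') := Metric.infDist_closure.symm
      _ ≤ dist (meshPoint E.δ x) p := Metric.infDist_le_dist_of_mem hp
  -- hence `closure A'` misses the disc of `y`
  have hmiss : ∀ p ∈ closure A',
      Metric.infDist (meshPoint E.δ y) (frontier E.Ω) < dist (meshPoint E.δ y) p := by
    intro p hp
    by_contra hle
    push Not at hle
    have hpB : p ∈ Metric.closedBall (meshPoint E.δ y)
        (Metric.infDist (meshPoint E.δ y) (frontier E.Ω)) := by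
      rw [Metric.mem_closedBall, dist_comm]; exact hle
    obtain ⟨x, hxX, hpx⟩ : ∃ x ∈ X, p ∈ Metric.closedBall (meshPoint E.δ x)
        (Metric.infDist (meshPoint E.δ x) (frontier E.Ω)) := by
      simpa only [mem_iUnion, exists_prop] using hcover hpB
    rw [Metric.mem_closedBall, dist_comm] at hpx
    exact (hfar x hxX p hp).not_ge hpx
  -- a nearest boundary point of `δy` is then outside `A'`
  have hJne : (frontier E.Ω).Nonempty := hne.mono sdiff_subset
  obtain ⟨q, hqJ, hq⟩ := isClosed_frontier.exists_infDist_eq_dist hJne (meshPoint E.δ y)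
  have hqA : q ∉ A' := fun h => (hmiss q (subset_closure h)).ne hq
  have hfy : Metric.infDist (meshPoint E.δ y) (frontier E.Ω \ A') ≤
      Metric.infDist (meshPoint E.δ y) (frontier E.Ω) := by
    rw [hq]; exact Metric.infDist_le_dist_of_mem ⟨hqJ, hqA⟩
  -- but `y` is on the arc: a point of `closure A'` is within that distance
  have hA' : (closure A').Nonempty := (nonempty_iff_ne_empty.2 hA).closure
  obtain ⟨p, hp, hpd⟩ := isClosed_closure.exists_infDist_eq_dist hA' (meshPoint E.δ y)
  have h3 := hmiss p hp
  rw [← hpd, Metric.infDist_closure] at h3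
  exact lt_irrefl _ ((hy.2.trans hfy).trans_lt h3)

/-- **Forcing, one disc.** If the disc of the boundary site `x` contains the disc of `y` and `y`
lies on the discrete arc of `A'` (`∂Ω ⊄ A'`), then so does `x`, for every marker set `A'`
(e.g. the centre of a plus-shaped cluster is selected by every marker set selecting an arm).
[folklore] -/
theorem mem_zdDiscreteArc_of_closedBall_subset {E : DiscreteDobrushin} {A' : Set ℂ} {x y : Site 2}
    (hx : x ∈ E.zdBoundary) (hy : y ∈ E.zdDiscreteArc A') (hne : (frontier E.Ω \ A').Nonempty)
    (hsub : Metric.closedBall (meshPoint E.δ y) (Metric.infDist (meshPoint E.δ y) (frontier E.Ω)) ⊆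
      Metric.closedBall (meshPoint E.δ x) (Metric.infDist (meshPoint E.δ x) (frontier E.Ω))) :
    x ∈ E.zdDiscreteArc A' := by
  obtain ⟨x', hx', h⟩ := exists_mem_zdDiscreteArc_of_closedBall_subset (X := {x})
    (singleton_subset_iff.2 hx) hy hne (by simpa only [mem_singleton_iff, iUnion_iUnion_eq_left])
  rw [mem_singleton_iff] at hx'
  exact hx' ▸ h

/-- **The admissibility no-go.** If a site of the discrete arc of `A` has its disc covered by the
discs of sites of the discrete arc of `B` (and `∂Ω ⊄ A`), the data are not admissible: one of the
covering sites lies on both arcs, violating `IsZdAdmissible.disjoint`.  This is the obstruction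
every construction of admissible markers for `stub_discretisable` has to avoid near the two cut
points. [folklore] -/
theorem not_isZdAdmissible_of_closedBall_subset {E : DiscreteDobrushin} {y : Site 2}
    {X : Set (Site 2)} (hy : y ∈ E.zdArcA) (hX : X ⊆ E.zdArcB)
    (hne : (frontier E.Ω \ E.arcA).Nonempty)
    (hcover : Metric.closedBall (meshPoint E.δ y) (Metric.infDist (meshPoint E.δ y) (frontier E.Ω)) ⊆
      ⋃ x ∈ X, Metric.closedBall (meshPoint E.δ x) (Metric.infDist (meshPoint E.δ x) (frontier E.Ω))) :
    ¬ E.IsZdAdmissible := by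
  intro hadm
  obtain ⟨x, hxX, hxA⟩ := exists_mem_zdDiscreteArc_of_closedBall_subset (A' := E.arcA)
    (fun x hx => E.zdArcB_subset_zdBoundary (hX hx)) hy hne hcover
  exact Set.disjoint_left.1 hadm.disjoint hxA (hX hxX)

/-- The no-go with the roles of the two arcs exchanged. [folklore] -/
theorem not_isZdAdmissible_of_closedBall_subset' {E : DiscreteDobrushin} {y : Site 2}
    {X : Set (Site 2)} (hy : y ∈ E.zdArcB) (hX : X ⊆ E.zdArcA)
    (hne : (frontier E.Ω \ E.arcB).Nonempty)
    (hcover : Metric.closedBall (meshPoint E.δ y) (Metric.infDist (meshPoint E.δ y) (frontier E.Ω)) ⊆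
      ⋃ x ∈ X, Metric.closedBall (meshPoint E.δ x) (Metric.infDist (meshPoint E.δ x) (frontier E.Ω))) :
    ¬ E.IsZdAdmissible := by
  intro hadm
  obtain ⟨x, hxX, hxB⟩ := exists_mem_zdDiscreteArc_of_closedBall_subset (A' := E.arcB)
    (fun x hx => E.zdArcA_subset_zdBoundary (hX hx)) hy hne hcover
  exact Set.disjoint_left.1 hadm.disjoint (hX hxX) hxB

/-! ### Realizability: markers off the boundary select exactly the discs they meet -/

/-- A point off `Ω̄` is strictly farther from a point `z ∈ Ω` than `∂Ω` is: the segment between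
them crosses the frontier strictly before its end.  Hence padding a marker set by exterior points
(to make it Hausdorff-close to a continuum arc) never selects a boundary site. [folklore] -/
theorem infDist_frontier_lt_dist_of_not_mem_closure {Ω : Set ℂ} {z q : ℂ} (hz : z ∈ Ω)
    (hq : q ∉ closure Ω) : Metric.infDist z (frontier Ω) < dist z q := by
  have hzq : z ≠ q := fun h => hq (h ▸ subset_closure hz)
  by_cases hzf : z ∈ frontier Ω
  · have h0 : Metric.infDist z (frontier Ω) = 0 := Metric.infDist_zero_of_mem hzf
    rw [h0]
    exact dist_pos.2 hzq
  -- otherwise `z` is an interior point and the segment `[z, q]` meets the frontier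
  have hzi : z ∈ interior Ω := by
    by_contra h
    exact hzf ⟨subset_closure hz, h⟩
  obtain ⟨w, hw, hwf⟩ : ∃ w ∈ segment ℝ z q, w ∈ frontier Ω := by
    by_contra h
    push Not at h
    have hsub : segment ℝ z q ⊆ interior Ω := by
      refine (convex_segment z q).isPreconnected.subset_of_closure_inter_subset isOpen_interior
        ⟨z, left_mem_segment ℝ z q, hzi⟩ ?_
      rintro w ⟨hwc, hws⟩
      by_contra hwi
      exact h w hws ⟨closure_mono interior_subset hwc, hwi⟩
    exact hq (interior_subset.trans subset_closure (hsub (right_mem_segment ℝ z q)))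
  have hwq : w ≠ q := fun h => hq (h ▸ frontier_subset_closure hwf)
  have hsum := dist_add_dist_of_mem_segment hw
  have hpos := dist_pos.2 hwq
  calc Metric.infDist z (frontier Ω) ≤ dist z w := Metric.infDist_le_dist_of_mem hwf
    _ < dist z q := by linarith

/-- For a nonempty marker set `A'` disjoint from `∂Ω`, a boundary site lies on the discrete arc of
`A'` iff the closure of `A'` meets its disc `closedBall (δx) (infDist (δx) ∂Ω)`: the complement
`∂Ω ∖ A'` is all of `∂Ω`, and the infimum distance to the closed set `closure A'` is attained.
[folklore] -/
theorem mem_zdDiscreteArc_iff_of_disjoint {E : DiscreteDobrushin} {A' : Set ℂ} {x : Site 2}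
    (hx : x ∈ E.zdBoundary) (hA : Disjoint A' (frontier E.Ω)) (hne : A'.Nonempty) :
    x ∈ E.zdDiscreteArc A' ↔
      ∃ p ∈ closure A', dist (meshPoint E.δ x) p ≤ Metric.infDist (meshPoint E.δ x) (frontier E.Ω) := by
  have hdiff : frontier E.Ω \ A' = frontier E.Ω := sdiff_eq_left.2 hA.symm
  rw [DiscreteDobrushin.mem_zdDiscreteArc_iff, hdiff]
  constructor
  · rintro ⟨-, h⟩
    obtain ⟨p, hp, hpd⟩ := isClosed_closure.exists_infDist_eq_dist hne.closure (meshPoint E.δ x)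
    refine ⟨p, hp, ?_⟩
    rwa [← hpd, Metric.infDist_closure]
  · rintro ⟨p, hp, hpd⟩
    refine ⟨hx, ?_⟩
    calc Metric.infDist (meshPoint E.δ x) A' = Metric.infDist (meshPoint E.δ x) (closure A') :=
          Metric.infDist_closure.symm
      _ ≤ dist (meshPoint E.δ x) p := Metric.infDist_le_dist_of_mem hp
      _ ≤ Metric.infDist (meshPoint E.δ x) (frontier E.Ω) := hpd

/-- **Marker realizability.** Let `S` be a finite nonempty set of boundary sites of discrete Dobrushin data,
and choose for each `s ∈ S` a witness point `p s` off `∂Ω`, inside the disc of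
`s` (`dist (δs) (p s) ≤ infDist (δs) ∂Ω`) and outside the disc of every boundary site not in `S`.
Then the marker set `p '' S ∪ P`, for any compact padding `P` outside `Ω̄`, selects exactly `S`:
`zdDiscreteArc (p '' S ∪ P) = S`.  (With `P` a finite exterior `δ`-net of a continuum arc this is
how Hausdorff-convergent admissible markers are to be produced for `stub_discretisable`.)
[folklore] -/
theorem zdDiscreteArc_eq_of_markers {E : DiscreteDobrushin} {S : Set (Site 2)}
    {p : Site 2 → ℂ} {P : Set ℂ} (hS : S ⊆ E.zdBoundary) (hfin : S.Finite) (hSne : S.Nonempty)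
    (hP : IsCompact P) (hPΩ : Disjoint P (closure E.Ω))
    (hpJ : ∀ s ∈ S, p s ∉ frontier E.Ω)
    (hp_in : ∀ s ∈ S, dist (meshPoint E.δ s) (p s) ≤ Metric.infDist (meshPoint E.δ s) (frontier E.Ω))
    (hp_out : ∀ s ∈ S, ∀ x ∈ E.zdBoundary, x ∉ S →
      Metric.infDist (meshPoint E.δ x) (frontier E.Ω) < dist (meshPoint E.δ x) (p s)) :
    E.zdDiscreteArc (p '' S ∪ P) = S := by
  -- the marker set is closed, nonempty and off the frontier
  have hclosed : IsClosed (p '' S ∪ P) := (hfin.image p).isClosed.union hP.isClosed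
  have hne : (p '' S ∪ P).Nonempty := (hSne.image p).mono subset_union_left
  have hdisj : Disjoint (p '' S ∪ P) (frontier E.Ω) := by
    rw [disjoint_union_left]
    refine ⟨Set.disjoint_left.2 ?_, hPΩ.mono_right frontier_subset_closure⟩
    rintro _ ⟨s, hs, rfl⟩ h
    exact hpJ s hs h
  ext x
  constructor
  · intro hx
    have hxb : x ∈ E.zdBoundary := hx.1
    obtain ⟨q, hq, hqd⟩ := (mem_zdDiscreteArc_iff_of_disjoint hxb hdisj hne).1 hx
    rw [hclosed.closure_eq] at hq
    have hxΩ : meshPoint E.δ x ∈ E.Ω :=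
      meshDomain_subset_meshVertices _ _ (E.zdBoundary_subset_meshDomain hxb)
    rcases hq with ⟨s, hs, rfl⟩ | hqP
    · by_contra hxS
      exact (hp_out s hs x hxb hxS).not_ge hqd
    · exact absurd hqd (infDist_frontier_lt_dist_of_not_mem_closure hxΩ
        (Set.disjoint_left.1 hPΩ hqP)).not_ge
  · intro hxS
    refine (mem_zdDiscreteArc_iff_of_disjoint (hS hxS) hdisj hne).2 ⟨p x, ?_, hp_in x hxS⟩
    exact subset_closure (Or.inl ⟨x, hxS, rfl⟩)

/-! ### Registered sub-goals (one-line signatures, verbatim) -/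

/-- **Registered sub-goal `stub_discretisable_forcing` of `stub_discretisable`**: the forcing
lemma `exists_mem_zdDiscreteArc_of_closedBall_subset` with explicit binders — a boundary site on
the discrete arc of `A'` whose disc is covered by the discs of the boundary sites `X` forces one
of them onto the arc (`∂Ω ⊄ A'`). [folklore] -/
theorem stub_discretisable_forcing : ∀ (E : DiscreteDobrushin) (A' : Set ℂ) (y : Site 2) (X : Set (Site 2)), X ⊆ E.zdBoundary → y ∈ E.zdDiscreteArc A' → (frontier E.Ω \ A').Nonempty → Metric.closedBall (meshPoint E.δ y) (Metric.infDist (meshPoint E.δ y) (frontier E.Ω)) ⊆ ⋃ x ∈ X, Metric.closedBall (meshPoint E.δ x) (Metric.infDist (meshPoint E.δ x) (frontier E.Ω)) → ∃ x ∈ X, x ∈ E.zdDiscreteArc A' :=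
  fun _ _ _ _ hX hy hne hcover => exists_mem_zdDiscreteArc_of_closedBall_subset hX hy hne hcover

/-- **Registered sub-goal `stub_discretisable_markers` of `stub_discretisable`**: the marker
realizability theorem `zdDiscreteArc_eq_of_markers` with explicit binders — witness points in the
discs of the intended sites and outside the discs of the others, padded by a compact set outside
`Ω̄`, select exactly the intended sites. [folklore] -/
theorem stub_discretisable_markers : ∀ (E : DiscreteDobrushin) (S : Set (Site 2)) (p : Site 2 → ℂ) (P : Set ℂ), S ⊆ E.zdBoundary → S.Finite → S.Nonempty → IsCompact P → Disjoint P (closure E.Ω) → (∀ s ∈ S, p s ∉ frontier E.Ω) → (∀ s ∈ S, dist (meshPoint E.δ s) (p s) ≤ Metric.infDist (meshPoint E.δ s) (frontier E.Ω)) → (∀ s ∈ S, ∀ x ∈ E.zdBoundary, x ∉ S → Metric.infDist (meshPoint E.δ x) (frontier E.Ω) < dist (meshPoint E.δ x) (p s)) → E.zdDiscreteArc (p '' S ∪ P) = S :=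
  fun _ _ _ _ hS hfin hSne hP hPΩ hpJ hp_in hp_out =>
    zdDiscreteArc_eq_of_markers hS hfin hSne hP hPΩ hpJ hp_in hp_out

end Summit.CriticalPhenomena.CardyFormulaZ2.Cruxes.LagHandOff.CrosscutDictionary

end
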